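import Summits.NavierStokesRegularity.NavierStokesRegularity.Theses.ExtremiserTransience

noncomputable section
open Set Filter Topology MeasureTheory
open Literature.Analysis.FluidPDE

namespace Summit.NavierStokesRegularity.NavierStokesRegularity.Cruxes.NearExtremalTransience.PeriodicSheet

local notation "E3" => EuclideanSpace ℝ (Fin 3)

/-- The periodicity cell `[0,L)² × ℝ` of a horizontally periodic field. -/
def cell (L : ℝ) : Set E3 := {x | x 0 ∈ Set.Ico 0 L ∧ x 1 ∈ Set.Ico 0 L}

/-- Horizontal cell mean of `W t` at height `x 2` (a function of `x` through `x 2` only). -/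
def hMean (W : ℝ → E3 → E3) (L t : ℝ) (x : E3) : E3 :=
  (1 / L ^ 2) • ∫ a in Set.Ico 0 L, ∫ b in Set.Ico 0 L,
    W t (x + EuclideanSpace.single 0 (a - x 0) + EuclideanSpace.single 1 (b - x 1))

/-- Per-cell fluctuation energy. -/
def cellFluctEnergy (W : ℝ → E3 → E3) (L t : ℝ) : ℝ :=
  ∫ x in cell L, ‖W t x - hMean W L t x‖ ^ 2

/-- «Sheet crystal»: a Type-I ancient KNSS blow-up limit, `L`-periodic in `x₁, x₂`, with finite per-cell energy. -/
def IsSheetCrystal (W : ℝ → E3 → E3) (L K : ℝ) : Prop :=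
  0 < L ∧ 0 < K ∧ IsKNSSBlowupLimit W ∧
    (∀ t < (0:ℝ), ∀ x, Real.sqrt (-t) * ‖W t x‖ ≤ K) ∧
    (∀ t x, W t (x + EuclideanSpace.single 0 L) = W t x) ∧
    (∀ t x, W t (x + EuclideanSpace.single 1 L) = W t x) ∧
    (∀ t < (0:ℝ), IntegrableOn (fun x => ‖W t x‖ ^ 2) (cell L)) ∧
    (∃ E₀ : ℝ, ∀ t < (0:ℝ), cellFluctEnergy W L t ≤ E₀)

/-- FIRST LEMMA (rung): a sheet crystal is trivial. -/
def PeriodicSheetTrivial : Prop :=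
  ∀ (W : ℝ → E3 → E3) (L K : ℝ), IsSheetCrystal W L K → ∀ t < (0:ℝ), ∀ x, W t x = 0

/-- The lever, typed: Poincaré-in-the-period backward growth of the per-cell fluctuation energy once the Type-I bound has made
`W` small (`t ≤ -T₀`): `E(t) ≥ exp(c (t₀ - t)) · E(t₀)` for `t ≤ t₀ ≤ -T₀`, `c = ½ (2π/L)²`. -/
def CellEnergyBackwardGrowth : Prop :=
  ∀ (W : ℝ → E3 → E3) (L K : ℝ), IsSheetCrystal W L K →
    ∃ T₀ : ℝ, 0 < T₀ ∧ ∀ t₀ ≤ -T₀, ∀ t ≤ t₀,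
      Real.exp ((1 / 2) * (2 * Real.pi / L) ^ 2 * (t₀ - t)) * cellFluctEnergy W L t₀ ≤ cellFluctEnergy W L t

/-- The mean part, eventual form: zero fluctuation on `(-∞, t₀]` makes `W` a horizontal shear flow there, i.e. a bounded ancient
solution of the 1-D heat equation in `x₃` (vertical mean velocity vanishes by incompressibility + finite cell energy), hence constant
(Widder–Liouville), hence zero by the Type-I decay. -/
def MeanHeatLiouvilleEventually : Prop :=
  ∀ (W : ℝ → E3 → E3) (L K t₀ : ℝ), IsSheetCrystal W L K → t₀ < 0 →
    (∀ t ≤ t₀, cellFluctEnergy W L t = 0) → ∀ t ≤ t₀, ∀ x, W t x = 0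

/-- Forward uniqueness of bounded mild solutions from zero data (KNSS blow-up limits are bounded mild solutions). -/
def ForwardUniquenessFromZero : Prop :=
  ∀ (W : ℝ → E3 → E3) (t₀ : ℝ), IsKNSSBlowupLimit W → t₀ < 0 → (∀ t ≤ t₀, ∀ x, W t x = 0) → ∀ t < (0:ℝ), ∀ x, W t x = 0

/-- Composition of the rung (real-analysis glue, kernel-checked): backward exponential growth of a nonzero fluctuation energy
contradicts its backward bound, so the fluctuation vanishes on `(-∞, -T₀]`; then the mean Liouville and forward uniqueness. -/
theorem periodicSheetTrivial_of (h1 : CellEnergyBackwardGrowth) (h2 : MeanHeatLiouvilleEventually)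
    (h3 : ForwardUniquenessFromZero) : PeriodicSheetTrivial := by
  intro W L K hW
  have hW' := hW
  obtain ⟨hL, hK, hlim, -, -, -, -, E₀, hE₀⟩ := hW'
  obtain ⟨T₀, hT₀, hgrow⟩ := h1 W L K hW
  have hEnn : ∀ t, 0 ≤ cellFluctEnergy W L t := fun t => by
    unfold cellFluctEnergy; exact integral_nonneg fun x => sq_nonneg _
  have hzero : ∀ t ≤ -T₀, cellFluctEnergy W L t = 0 := by
    intro t₀ ht₀
    by_contra hne
    have hpos : 0 < cellFluctEnergy W L t₀ := lt_of_le_of_ne (hEnn t₀) (Ne.symm hne)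
    set c : ℝ := (1 / 2) * (2 * Real.pi / L) ^ 2 with hc
    have hc0 : 0 < c := by rw [hc]; positivity
    obtain ⟨R, hR⟩ : ∃ R : ℝ, E₀ / cellFluctEnergy W L t₀ < Real.exp R := by
      refine ⟨Real.log (max (E₀ / cellFluctEnergy W L t₀) 1) + 1, ?_⟩
      have hm : 0 < max (E₀ / cellFluctEnergy W L t₀) 1 := lt_of_lt_of_le one_pos (le_max_right _ _)
      calc E₀ / cellFluctEnergy W L t₀ ≤ max (E₀ / cellFluctEnergy W L t₀) 1 := le_max_left _ _
        _ = Real.exp (Real.log (max (E₀ / cellFluctEnergy W L t₀) 1)) := (Real.exp_log hm).symm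
        _ < Real.exp (Real.log (max (E₀ / cellFluctEnergy W L t₀) 1) + 1) := Real.exp_strictMono (by linarith)
    set s : ℝ := t₀ - max R 0 / c with hs
    have hst : s ≤ t₀ := by
      have : 0 ≤ max R 0 / c := div_nonneg (le_max_right _ _) hc0.le
      rw [hs]; linarith
    have hs0 : s < 0 := lt_of_le_of_lt hst (lt_of_le_of_lt ht₀ (by linarith))
    have hg := hgrow t₀ ht₀ s hst
    have hexp : Real.exp R ≤ Real.exp (c * (t₀ - s)) := by
      apply Real.exp_monotone
      have : c * (t₀ - s) = max R 0 := by rw [hs]; field_simp; ring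
      rw [this]; exact le_max_left _ _
    have h1' : E₀ < Real.exp (c * (t₀ - s)) * cellFluctEnergy W L t₀ := by
      have := (div_lt_iff₀ hpos).mp (lt_of_lt_of_le hR hexp)
      linarith
    have h2' : cellFluctEnergy W L s ≤ E₀ := hE₀ s hs0
    have hg' : Real.exp (c * (t₀ - s)) * cellFluctEnergy W L t₀ ≤ cellFluctEnergy W L s := by
      simpa [hc] using hg
    linarith
  have hT₀neg : -T₀ < 0 := by linarith
  exact h3 W (-T₀) hlim hT₀neg (h2 W L K (-T₀) hW hT₀neg hzero)

end Summit.NavierStokesRegularity.NavierStokesRegularity.Cruxes.NearExtremalTransience.PeriodicSheet
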